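import Summits.QuantumFields.YangMills.Theorems.LangevinControlUVOSLegsFromFemtoAndGapStubCollar
import Summits.QuantumFields.YangMills.Theorems.LangevinControlUVOSLegsFromFemtoAndGapStubAssemblyLowDegree
import HarnessLib

/-!
# Crux `ResponseLocalisation` (stmt-QuantumFields-24293), far stub `Repair.stub_far : FarSigR`:
# the EXPLICIT collar identity — the third cumulant IS the torus mean of a product of three small boundary functionals

Support file (`--supports stmt-QuantumFields-24293`) of the width prover `ym-line-frs-p2` (lead `ym-line-frs-p1`), route
`ForcedResponseSkewness`.  The tree's collar transfer (`Literature…LatticeGaugeDLRFarFactorProofs.abs_integral_prod_sub_mean_le`,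
`DlrCollarTransfer.stub_collar`, `NT.CeilingPrice.abs_torusK3_le_of_e1osc`) only records the BOUND `|κ₃| ≤ (2C₁/R⁴)³`; the far stub of
24293 needs the identity behind it, because its remaining content is a CLUSTERING step applied to the collared functionals (evidence note
`evidence-24293-far-IR.md` on the item: «collar first, cluster second» — the only order that keeps the hyperscaling factor `(aβ)¹²`):

* §1 `integral_prod_collar_mul_prod_eq` — for bounded continuous cylinder observables `A₁ … Aₙ` read through the periodic lift, link sets
  `Λᵢ` with the injectivity/separation side conditions of `abs_integral_prod_sub_mean_le`, ANY constants `mᵢ` and ANY set `T` of sites: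
  `∫ (∏_{i∈T} (γ_{Λᵢ}Aᵢ − mᵢ)) · ∏_{i∉T} (Aᵢ − mᵢ) dμ_T = ∫ ∏ᵢ (Aᵢ − mᵢ) dμ_T` (one torus DLR step per site of `T`, the other factors as far
  factor; no kernel bound is needed for the identity).  Adapted (proof copied, kernel hypothesis dropped) from the tree's
  `abs_integral_prod_sub_mean_le` (Georgii 2011 Thm. 4.17 / (4.18); Seiler LNP 159 Ch. 2).
* §2 the three action densities on the odd torus `(ℤ/(2L+1))⁴` with the centred cubes of side `2R+3` of `stub_collar`:
  `torusK3_eq_torusE_collar` — `torusK3_{β,L}(x,y,z) = E_T[h_x h_y h_z]`, `h_w(η) := γ_{B_w}(dens_w)(η) − E_T dens_w`, for pairwise torus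
  separation `≥ 2R+4`, `1 ≤ R`, `4R+8 ≤ L`; `torusE_dens_eq_torusE_kerE_centred` (DLR with trivial far factor); `abs_collar_le` — under an
  FBL-type kernel bound at `β` (`|γ_B(dens_w)(η) − p| ≤ C₁/depth⁴` for every exterior, cubes of side `(2R+3)·aβ ≤ ℓ₁`) every `h_w` has
  `‖h_w‖_∞ ≤ 2C₁/R⁴`; `isCylinder_collar` / `continuous_collar` — `h_w` is a continuous cylinder observable supported within sup-distance `R+2`
  of `w` (what a clustering hypothesis is applied to).

Honest label: bookkeeping toward ONE stub of a CONDITIONAL rung line (leaf R2a `BalabanLadder.NT`); the far stub itself needs a gap-class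
clustering input on top of this (not claimed here); nothing here bears on the Yang–Mills mass gap, which is NOT proved by any of this.
-/

set_option autoImplicit false

noncomputable section

open MeasureTheory Filter Topology
open Literature.MathematicalPhysics.QuantumFieldTheory Literature.MathematicalPhysics.QuantumLattice
open Literature.Probability.LatticeModels
open Summit.QuantumFields.YangMills.Cruxes.OSLegsFromFemtoAndGap.DlrCollarTransfer
open Summit.QuantumFields.YangMills.Theorems.OSLegsFromFemtoAndGap (torusMoment torusMoment_three torusE_dens_eq_wilsonTorusMean)

namespace Summit.QuantumFields.YangMills.Cruxes.ResponseLocalisation.Far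

/-! ## §1 The explicit collar identity on a torus Wilson state -/

section CollarIdentity

variable {d N : ℕ} {G : Type*} [Group G] [TopologicalSpace G] [IsTopologicalGroup G]
  [CompactSpace G] [MeasurableSpace G] [BorelSpace G] [SecondCountableTopology G]
  (ρ : G →* Matrix (Fin N) (Fin N) ℂ)

/-- **Explicit collar identity.**  On the torus of side `L`, let `A₁, …, Aₙ` be bounded continuous cylinder observables of `ℤ^d`
(supports `Sᵢ`) read through the periodic lift, `Λ₁, …, Λₙ` finite link sets with (i) each `Λᵢ ∪ Sᵢ ∪ ∂Λᵢ` injecting into the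
torus and (ii) for `i ≠ j` the torus images of `Sⱼ ∪ ∂Λⱼ` and of `Λᵢ` disjoint, `gᵢ = γ_{Λᵢ}Aᵢ` the kernel means and `mᵢ` ANY
constants.  Then for every set `T` of sites, replacing the raw centred factors `Aᵢ − mᵢ`, `i ∈ T`, by the collared ones `gᵢ − mᵢ`
does not change the torus expectation of the product: one DLR step per site of `T`
(`integral_torusLift_mul_eq_integral_ymSpecification_mul`), the remaining factors forming the far factor.  Adapted from the tree's
`abs_integral_prod_sub_mean_le` (same induction, kernel bound dropped). [folklore] -/
theorem integral_prod_collar_mul_prod_eq (hρ : Continuous ρ) (β : ℝ) {L : ℕ} [NeZero L] {n : ℕ}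
    (Λ S : Fin n → Finset (Literature.MathematicalPhysics.QuantumLattice.ZdEdge d))
    (A : Fin n → LGConfig d G → ℝ) (hAc : ∀ i, Continuous (A i)) {CA : ℝ} (hAb : ∀ i U, |A i U| ≤ CA)
    (hAS : ∀ i, IsCylinder (A i) (S i))
    (hinj : ∀ i, Set.InjOn (Torus.proj L)
      ((Λ i ∪ S i ∪ (plaquettesTouching (Λ i)).biUnion plaquetteEdges).image Prod.fst : Set (Site d)))
    (hfar : ∀ i j, i ≠ j → ∀ e ∈ S j ∪ (plaquettesTouching (Λ j)).biUnion plaquetteEdges, ∀ e' ∈ Λ i,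
      torusEdge L e ≠ torusEdge L e')
    (g : Fin n → LGConfig d G → ℝ) (hg : ∀ i η, g i η = ∫ U, A i U ∂(ymSpecification ρ β (Λ i) η))
    (m : Fin n → ℝ) (T : Finset (Fin n)) :
    ∫ V, (∏ i ∈ T, (g i (torusLift L V) - m i)) * ∏ i ∈ Tᶜ, (A i (torusLift L V) - m i) ∂(wilsonMeasure ρ β) =
      ∫ V, ∏ i, (A i (torusLift L V) - m i) ∂(wilsonMeasure ρ β) := by
  classical
  haveI := isProbabilityMeasure_wilsonMeasure (d := d) (L := L) ρ hρ β
  have hgfun : ∀ i, g i = fun η => ∫ U, A i U ∂(ymSpecification ρ β (Λ i) η) := fun i => funext (hg i)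
  -- collared observables
  set h : Fin n → LGConfig d G → ℝ := fun i η => g i η - m i with hhdef
  have hgcyl : ∀ i, IsCylinder (g i) (S i ∪ (plaquettesTouching (Λ i)).biUnion plaquetteEdges) := fun i => by
    rw [hgfun i]; exact dependsOn_integral_ymSpecification ρ hρ β (Λ i) (hAc i).measurable (hAS i)
  have hgc : ∀ i, Continuous (g i) := fun i => by
    rw [hgfun i]; exact continuous_integral_ymSpecification ρ hρ β (Λ i) (hAc i) (hAb i)
  have hgb : ∀ i η, |g i η| ≤ CA := fun i η => by
    rw [hg i η]; exact abs_integral_ymSpecification_le ρ hρ β (Λ i) (hAb i) η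
  have hhb : ∀ i η, |h i η| ≤ CA + |m i| := fun i η => by
    simp only [hhdef]
    exact (abs_sub _ _).trans (add_le_add_left (hgb i η) _)
  have hhcyl : ∀ i, IsCylinder (h i) (S i ∪ (plaquettesTouching (Λ i)).biUnion plaquetteEdges) :=
    fun i U V hUV => by simp only [hhdef, hgcyl i hUV]
  have hhc : ∀ i, Continuous (h i) := fun i => (hgc i).sub continuous_const
  -- far factors do not feel the links over `Λ i`
  have hhfar : ∀ i j, i ≠ j → ∀ W V,
      h j (torusLift L (((Λ i).image (torusEdge L)).piecewise W V)) = h j (torusLift L V) :=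
    fun i j hij W V => apply_torusLift_piecewise_eq (hhcyl j) (hfar i j hij) W V
  have hAfar : ∀ i j, i ≠ j → ∀ W V,
      A j (torusLift L (((Λ i).image (torusEdge L)).piecewise W V)) = A j (torusLift L V) :=
    fun i j hij W V => apply_torusLift_piecewise_eq (hAS j)
      (fun e he => hfar i j hij e (Finset.mem_union_left _ he)) W V
  show ∫ V, (∏ i ∈ T, h i (torusLift L V)) * ∏ i ∈ Tᶜ, (A i (torusLift L V) - m i) ∂(wilsonMeasure ρ β) =
      ∫ V, ∏ i, (A i (torusLift L V) - m i) ∂(wilsonMeasure ρ β)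
  -- induction on the set `T` of collared sites
  induction T using Finset.induction_on with
  | empty => simp
  | @insert i T hiT ih =>
    rw [← ih]
    have hTc : Tᶜ = insert i (insert i T)ᶜ := (Finset.insert_compl_insert hiT).symm
    have hi' : i ∉ (insert i T)ᶜ := fun hh => (Finset.mem_compl.1 hh) (Finset.mem_insert_self i T)
    rw [hTc]
    simp only [Finset.prod_insert hiT, Finset.prod_insert hi']
    -- the far factor of the DLR step at `i`
    set H : GaugeConfig d L G → ℝ := fun V =>
      (∏ j ∈ T, h j (torusLift L V)) * ∏ j ∈ (insert i T)ᶜ, (A j (torusLift L V) - m j) with hHdef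
    have hHc : Continuous H :=
      (continuous_finsetProd T fun j _ => (hhc j).comp (continuous_torusLift L)).mul
        (continuous_finsetProd _ fun j _ =>
          ((hAc j).comp (continuous_torusLift L)).sub continuous_const)
    have hHb : ∀ V, |H V| ≤ (∏ j ∈ T, (CA + |m j|)) * ∏ j ∈ (insert i T)ᶜ, (CA + |m j|) := fun V => by
      simp only [hHdef, abs_mul]
      refine mul_le_mul (abs_prod_le_prod T (f := fun j V => h j (torusLift L V)) (fun j _ V => hhb j _) V)
        (abs_prod_le_prod _ (f := fun j V => A j (torusLift L V) - m j)
          (fun j _ V => (abs_sub _ _).trans (add_le_add_left (hAb j _) _)) V)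
        (abs_nonneg _) ?_
      exact Finset.prod_nonneg fun j _ => (abs_nonneg _).trans (hhb j (torusLift L V))
    have hHpw : ∀ W V, H (((Λ i).image (torusEdge L)).piecewise W V) = H V := by
      intro W V
      simp only [hHdef]
      congr 1
      · exact Finset.prod_congr rfl fun j hj => hhfar i j (fun e => hiT (e ▸ hj)) W V
      · exact Finset.prod_congr rfl fun j hj => by rw [hAfar i j (fun e => hi' (e ▸ hj)) W V]
    have key := integral_torusLift_mul_eq_integral_ymSpecification_mul ρ hρ β (Λ i)
      (F := fun U => A i U - m i) ((hAc i).sub continuous_const) (C := CA + |m i|)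
      (fun U => (abs_sub _ _).trans (add_le_add_left (hAb i U) _)) (S₀ := S i)
      (fun U V hUV => by simp only [hAS i hUV]) (hinj i) hHc.measurable hHb hHpw
    have hkern : ∀ V, ∫ U, (A i U - m i) ∂(ymSpecification ρ β (Λ i) (torusLift L V)) =
        h i (torusLift L V) := by
      intro V
      haveI := isProbabilityMeasure_ymSpecification ρ hρ β (Λ i) (torusLift L V)
      simp only [hhdef, hg i]
      exact integral_sub_const_of_abs_le (hAc i).measurable (hAb i) (m i)
    simp only [hkern] at key
    calc ∫ V, h i (torusLift L V) * (∏ j ∈ T, h j (torusLift L V)) *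
            ∏ j ∈ (insert i T)ᶜ, (A j (torusLift L V) - m j) ∂(wilsonMeasure ρ β)
        = ∫ V, h i (torusLift L V) * H V ∂(wilsonMeasure ρ β) := by
          refine integral_congr_ae (ae_of_all _ fun V => ?_)
          simp only [hHdef]
          ring
      _ = ∫ V, (A i (torusLift L V) - m i) * H V ∂(wilsonMeasure ρ β) := key.symm
      _ = ∫ V, (∏ j ∈ T, h j (torusLift L V)) * ((A i (torusLift L V) - m i) *
            ∏ j ∈ (insert i T)ᶜ, (A j (torusLift L V) - m j)) ∂(wilsonMeasure ρ β) := by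
          refine integral_congr_ae (ae_of_all _ fun V => ?_)
          simp only [hHdef]
          ring

/-- **All sites collared**: `∫ ∏ᵢ (γ_{Λᵢ}Aᵢ − mᵢ) dμ_T = ∫ ∏ᵢ (Aᵢ − mᵢ) dμ_T` (the case `T = univ` of
`integral_prod_collar_mul_prod_eq`). [folklore] -/
theorem integral_prod_collar_eq (hρ : Continuous ρ) (β : ℝ) {L : ℕ} [NeZero L] {n : ℕ}
    (Λ S : Fin n → Finset (Literature.MathematicalPhysics.QuantumLattice.ZdEdge d))
    (A : Fin n → LGConfig d G → ℝ) (hAc : ∀ i, Continuous (A i)) {CA : ℝ} (hAb : ∀ i U, |A i U| ≤ CA)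
    (hAS : ∀ i, IsCylinder (A i) (S i))
    (hinj : ∀ i, Set.InjOn (Torus.proj L)
      ((Λ i ∪ S i ∪ (plaquettesTouching (Λ i)).biUnion plaquetteEdges).image Prod.fst : Set (Site d)))
    (hfar : ∀ i j, i ≠ j → ∀ e ∈ S j ∪ (plaquettesTouching (Λ j)).biUnion plaquetteEdges, ∀ e' ∈ Λ i,
      torusEdge L e ≠ torusEdge L e')
    (g : Fin n → LGConfig d G → ℝ) (hg : ∀ i η, g i η = ∫ U, A i U ∂(ymSpecification ρ β (Λ i) η))
    (m : Fin n → ℝ) :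
    ∫ V, ∏ i, (g i (torusLift L V) - m i) ∂(wilsonMeasure ρ β) =
      ∫ V, ∏ i, (A i (torusLift L V) - m i) ∂(wilsonMeasure ρ β) := by
  classical
  have h := integral_prod_collar_mul_prod_eq ρ hρ β Λ S A hAc hAb hAS hinj hfar g hg m Finset.univ
  simpa only [Finset.compl_univ, Finset.prod_empty, mul_one] using h

end CollarIdentity

/-! ## §2 The three action densities: `torusK3 = E_T[h_x h_y h_z]` with explicit small collared functionals -/

section Densities

variable (G : Type) [Group G] [TopologicalSpace G] [IsTopologicalGroup G] [CompactSpace G]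
  [MeasurableSpace G] [BorelSpace G] (r : LatticeRep G)

/-- **DLR with trivial far factor for the action density**: the torus mean of `dens_x` is the torus mean of its
kernel mean over the centred cube of side `2R+3` (`1 ≤ R`, `4R+8 ≤ L`). [folklore] -/
theorem torusE_dens_eq_torusE_kerE_centred (β : ℝ) {L R : ℕ} (hR : 1 ≤ R) (hRL : 4 * R + 8 ≤ L)
    (x : Fin 4 → ℤ) :
    torusE G r β L (dens G r x) =
      torusE G r β L (fun η => kerE G r β (fun k => x k - (R + 1)) (2 * R + 3) η (dens G r x)) := by
  haveI : SecondCountableTopology G :=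
    (r.continuous.isClosedEmbedding r.injective).isEmbedding.secondCountableTopology
  obtain ⟨CA, hCA⟩ := r.curvature.bounded
  have h1 := integral_torusLift_mul_eq_integral_ymSpecification_mul (d := 4) r.ρ r.continuous β (L := 2 * L + 1)
    (cubeEdges (fun k => x k - (R + 1)) (2 * R + 3)) (continuous_dens r x) (fun U => hCA _)
    (isCylinder_dens_cube r hR x) (injOn_torusProj_cube hRL x) (H := fun _ => (1 : ℝ)) measurable_const (D := 1)
    (fun _ => by simp) (fun _ _ => rfl)
  unfold torusE kerE
  simpa using h1

/-- **The explicit collar identity for the third cumulant.**  For three sites of pairwise torus sup-separation `≥ 2R+4`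
(`1 ≤ R`, `4R+8 ≤ L`), with `h_w(η) := γ_{B_w}(dens_w)(η) − E_T dens_w` the collared density over the centred cube `B_w` of
side `2R+3`:  `torusK3_{β,L}(x,y,z) = E_T[h_x · h_y · h_z]` (third cumulant = centred third moment, `torusMoment_three`; then
`integral_prod_collar_eq` with the cubes of `stub_collar`). [folklore] -/
theorem torusK3_eq_torusE_collar (β : ℝ) {L R : ℕ} (hR : 1 ≤ R) (hRL : 4 * R + 8 ≤ L) (x y z : Fin 4 → ℤ)
    (hxy : ∃ k : Fin 4, (2 * (R : ℤ) + 4) ≤ |((((x k - y k : ℤ) : ZMod (2 * L + 1))).valMinAbs : ℤ)|)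
    (hxz : ∃ k : Fin 4, (2 * (R : ℤ) + 4) ≤ |((((x k - z k : ℤ) : ZMod (2 * L + 1))).valMinAbs : ℤ)|)
    (hyz : ∃ k : Fin 4, (2 * (R : ℤ) + 4) ≤ |((((y k - z k : ℤ) : ZMod (2 * L + 1))).valMinAbs : ℤ)|) :
    torusK3 G r β L x y z =
      torusE G r β L (fun η =>
        (kerE G r β (fun k => x k - (R + 1)) (2 * R + 3) η (dens G r x) - torusE G r β L (dens G r x)) *
        (kerE G r β (fun k => y k - (R + 1)) (2 * R + 3) η (dens G r y) - torusE G r β L (dens G r y)) *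
        (kerE G r β (fun k => z k - (R + 1)) (2 * R + 3) η (dens G r z) - torusE G r β L (dens G r z))) := by
  haveI : SecondCountableTopology G :=
    (r.continuous.isClosedEmbedding r.injective).isEmbedding.secondCountableTopology
  obtain ⟨CA, hCA⟩ := r.curvature.bounded
  -- the sites, the cubes, the side conditions of the collar identity (as in `stub_collar`)
  set v : Fin 3 → (Fin 4 → ℤ) := ![x, y, z] with hv
  have flip : ∀ {u w : Fin 4 → ℤ}, (∃ k : Fin 4, (2 * (R : ℤ) + 4) ≤
      |((((u k - w k : ℤ) : ZMod (2 * L + 1))).valMinAbs : ℤ)|) →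
      ∃ k : Fin 4, (2 * (R : ℤ) + 4) ≤ |((((w k - u k : ℤ) : ZMod (2 * L + 1))).valMinAbs : ℤ)| := by
    rintro u w ⟨k, hk⟩
    refine ⟨k, ?_⟩
    have e : ((w k - u k : ℤ) : ZMod (2 * L + 1)) = -((u k - w k : ℤ) : ZMod (2 * L + 1)) := by push_cast; ring
    rwa [e, Int.abs_eq_natAbs, ZMod.natAbs_valMinAbs_neg, ← Int.abs_eq_natAbs]
  have hsep : ∀ i j : Fin 3, i ≠ j → ∃ k : Fin 4,
      (2 * (R : ℤ) + 4) ≤ |((((v i k - v j k : ℤ) : ZMod (2 * L + 1))).valMinAbs : ℤ)| := by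
    intro i j hij
    fin_cases i <;> fin_cases j
    · exact absurd rfl hij
    · simpa [hv] using hxy
    · simpa [hv] using hxz
    · simpa [hv] using flip hxy
    · exact absurd rfl hij
    · simpa [hv] using hyz
    · simpa [hv] using flip hxz
    · simpa [hv] using flip hyz
    · exact absurd rfl hij
  have hAc : ∀ i : Fin 3, Continuous (dens G r (v i)) := fun i => continuous_dens r (v i)
  have hAb : ∀ (i : Fin 3) (U : LGConfig 4 G), |dens G r (v i) U| ≤ CA := fun i U => hCA _
  have hAS : ∀ i : Fin 3, IsCylinder (dens G r (v i)) (cubeEdges (fun k => v i k - (R + 1)) (2 * R + 3)) :=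
    fun i => isCylinder_dens_cube r hR (v i)
  have hinj : ∀ i : Fin 3, Set.InjOn (Torus.proj (2 * L + 1))
      (((cubeEdges (fun k => v i k - (R + 1)) (2 * R + 3) ∪ cubeEdges (fun k => v i k - (R + 1)) (2 * R + 3) ∪
          (plaquettesTouching (cubeEdges (fun k => v i k - (R + 1)) (2 * R + 3))).biUnion plaquetteEdges).image
          Prod.fst : Set (Fin 4 → ℤ))) := fun i => injOn_torusProj_cube hRL (v i)
  have hfar : ∀ i j : Fin 3, i ≠ j → ∀ e ∈ cubeEdges (fun k => v j k - (R + 1)) (2 * R + 3) ∪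
      (plaquettesTouching (cubeEdges (fun k => v j k - (R + 1)) (2 * R + 3))).biUnion plaquetteEdges,
      ∀ e' ∈ cubeEdges (fun k => v i k - (R + 1)) (2 * R + 3),
      torusEdge (2 * L + 1) e ≠ torusEdge (2 * L + 1) e' :=
    fun i j hij e he e' he' => torusEdge_ne_cube (hsep i j hij) he he'
  -- third cumulant = centred third moment
  have h3 := torusMoment_three (G := G) r β L v
  have hv0 : v 0 = x := by simp [hv]
  have hv1 : v 1 = y := by simp [hv]
  have hv2 : v 2 = z := by simp [hv]
  rw [hv0, hv1, hv2] at h3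
  rw [← h3]
  -- the explicit collar identity with the common constant `m i = ⟨dens⟩_T` (the torus mean, any site)
  have key := integral_prod_collar_eq (d := 4) r.ρ r.continuous β (L := 2 * L + 1) (n := 3)
    (fun i => cubeEdges (fun k => v i k - (R + 1)) (2 * R + 3))
    (fun i => cubeEdges (fun k => v i k - (R + 1)) (2 * R + 3))
    (fun i => dens G r (v i)) hAc hAb hAS hinj hfar
    (fun i η => kerE G r β (fun k => v i k - (R + 1)) (2 * R + 3) η (dens G r (v i))) (fun i η => rfl)
    (fun _ => wilsonTorusMean r.ρ β L r.curvature.F)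
  have hdens : ∀ (i : Fin 3) (U : LGConfig 4 G), r.curvature.F (configShift (-(v i)) U) = dens G r (v i) U :=
    fun i U => rfl
  rw [torusE_dens_eq_wilsonTorusMean (G := G) r β L x, torusE_dens_eq_wilsonTorusMean (G := G) r β L y,
    torusE_dens_eq_wilsonTorusMean (G := G) r β L z]
  unfold torusMoment
  simp only [hdens]
  rw [← key]
  unfold torusE
  simp only [Fin.prod_univ_three, hv0, hv1, hv2]

/-- **Sup bound on the collared density under a femto boundary law at `β`.**  If every kernel mean of the action density at
depth `d ≥ 2` in cubes of side `b·aβ ≤ ℓ₁` is within `C₁/d⁴` of `p` (FBL at `β`), then for `1 ≤ R`, `(2R+3)·aβ ≤ ℓ₁`,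
`4R+8 ≤ L` the collared density `h_x = γ_{B_x}(dens_x) − E_T dens_x` over the centred cube of side `2R+3` satisfies
`|h_x(η)| ≤ 2C₁/R⁴` for EVERY `η` (kernel mean AND torus mean are within `C₁/R⁴` of `p`). [folklore] -/
theorem abs_collar_le (β : ℝ) {aβ C₁ ℓ₁ p : ℝ} (hC₁ : 0 ≤ C₁)
    (hF : ∀ (c : Fin 4 → ℤ) (b : ℕ), (b : ℝ) * aβ ≤ ℓ₁ → ∀ (η : LGConfig 4 G) (w : Fin 4 → ℤ),
      2 ≤ depth c b w → |kerE G r β c b η (dens G r w) - p| ≤ C₁ / (depth c b w : ℝ) ^ 4)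
    {L R : ℕ} (hR : 1 ≤ R) (hb : ((2 * R + 3 : ℕ) : ℝ) * aβ ≤ ℓ₁) (hRL : 4 * R + 8 ≤ L)
    (x : Fin 4 → ℤ) (η : LGConfig 4 G) :
    |kerE G r β (fun k => x k - (R + 1)) (2 * R + 3) η (dens G r x) - torusE G r β L (dens G r x)| ≤
      2 * C₁ / (R : ℝ) ^ 4 := by
  have hker : ∀ ζ, |kerE G r β (fun k => x k - (R + 1)) (2 * R + 3) ζ (dens G r x) - p| ≤ C₁ / (R : ℝ) ^ 4 :=
    fun ζ => abs_kerE_dens_centred_sub_le r hC₁ hF hR hb x ζ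
  have hmean : |torusE G r β L (dens G r x) - p| ≤ C₁ / (R : ℝ) ^ 4 := by
    haveI : SecondCountableTopology G :=
    (r.continuous.isClosedEmbedding r.injective).isEmbedding.secondCountableTopology
    obtain ⟨CA, hCA⟩ := r.curvature.bounded
    rw [torusE_dens_eq_torusE_kerE_centred G r β hR hRL x]
    have hgc : Continuous fun ζ => kerE G r β (fun k => x k - (R + 1)) (2 * R + 3) ζ (dens G r x) := by
      unfold kerE
      exact continuous_integral_ymSpecification r.ρ r.continuous β _ (continuous_dens r x) (fun U => hCA _)
    have hgb : ∀ ζ, |kerE G r β (fun k => x k - (R + 1)) (2 * R + 3) ζ (dens G r x)| ≤ CA := fun ζ => by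
      unfold kerE
      exact abs_integral_ymSpecification_le r.ρ r.continuous β _ (fun U => hCA _) ζ
    haveI := isProbabilityMeasure_wilsonMeasure (d := 4) (L := 2 * L + 1) r.ρ r.continuous β
    have e1 : torusE G r β L (fun ζ => kerE G r β (fun k => x k - (R + 1)) (2 * R + 3) ζ (dens G r x)) - p =
        ∫ U, (kerE G r β (fun k => x k - (R + 1)) (2 * R + 3) (torusLift (2 * L + 1) U) (dens G r x) - p)
          ∂(wilsonMeasure (d := 4) (L := 2 * L + 1) r.ρ β) := by
      unfold torusE
      rw [integral_sub_const_of_abs_le (μ := wilsonMeasure (d := 4) (L := 2 * L + 1) r.ρ β)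
        (f := fun U => kerE G r β (fun k => x k - (R + 1)) (2 * R + 3) (torusLift (2 * L + 1) U) (dens G r x))
        (by exact (hgc.comp (continuous_torusLift _)).measurable) (fun U => hgb _) p]
    rw [e1]
    exact abs_integral_le_of_abs_le fun U => hker _
  calc |kerE G r β (fun k => x k - (R + 1)) (2 * R + 3) η (dens G r x) - torusE G r β L (dens G r x)|
      = |(kerE G r β (fun k => x k - (R + 1)) (2 * R + 3) η (dens G r x) - p) -
          (torusE G r β L (dens G r x) - p)| := by congr 1; ring
    _ ≤ |kerE G r β (fun k => x k - (R + 1)) (2 * R + 3) η (dens G r x) - p| +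
          |torusE G r β L (dens G r x) - p| := abs_sub _ _
    _ ≤ C₁ / (R : ℝ) ^ 4 + C₁ / (R : ℝ) ^ 4 := add_le_add (hker η) hmean
    _ = 2 * C₁ / (R : ℝ) ^ 4 := by ring

/-- The collared density is a cylinder observable supported on the centred cube of side `2R+3` and the edges of the
plaquettes touching it — all within sup-distance `R+2` of `x`. [folklore] -/
theorem isCylinder_collar (β : ℝ) (L R : ℕ) (hR : 1 ≤ R) (x : Fin 4 → ℤ) :
    IsCylinder (fun η => kerE G r β (fun k => x k - (R + 1)) (2 * R + 3) η (dens G r x) - torusE G r β L (dens G r x))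
      (cubeEdges (fun k => x k - (R + 1)) (2 * R + 3) ∪
        (plaquettesTouching (cubeEdges (fun k => x k - (R + 1)) (2 * R + 3))).biUnion plaquetteEdges) := by
  haveI : SecondCountableTopology G :=
    (r.continuous.isClosedEmbedding r.injective).isEmbedding.secondCountableTopology
  have hg : IsCylinder (fun η => kerE G r β (fun k => x k - (R + 1)) (2 * R + 3) η (dens G r x))
      (cubeEdges (fun k => x k - (R + 1)) (2 * R + 3) ∪
        (plaquettesTouching (cubeEdges (fun k => x k - (R + 1)) (2 * R + 3))).biUnion plaquetteEdges) := by
    unfold kerE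
    exact dependsOn_integral_ymSpecification r.ρ r.continuous β _ (continuous_dens r x).measurable
      (isCylinder_dens_cube r hR x)
  intro U V hUV
  simp only [hg hUV]

/-- Every edge in the support of the collared density is based within sup-distance `R+2` of `x`. [folklore] -/
theorem near_of_mem_collarSupport {R : ℕ} {x : Fin 4 → ℤ} {e : Literature.MathematicalPhysics.QuantumLattice.ZdEdge 4}
    (he : e ∈ cubeEdges (fun k => x k - (R + 1)) (2 * R + 3) ∪
      (plaquettesTouching (cubeEdges (fun k => x k - (R + 1)) (2 * R + 3))).biUnion plaquetteEdges) (j : Fin 4) :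
    |e.1 j - x j| ≤ (R : ℤ) + 2 := by
  rcases Finset.mem_union.1 he with h | h
  · exact (near_of_mem_cubeSites_centred (fst_mem_cubeSites_of_mem_cubeEdges h) j).trans (by linarith)
  · exact near_of_mem_boundary_centred h j

/-- The collared density is continuous. [folklore] -/
theorem continuous_collar (β : ℝ) (L R : ℕ) (x : Fin 4 → ℤ) :
    Continuous fun η => kerE G r β (fun k => x k - (R + 1)) (2 * R + 3) η (dens G r x) - torusE G r β L (dens G r x) := by
  haveI : SecondCountableTopology G :=
    (r.continuous.isClosedEmbedding r.injective).isEmbedding.secondCountableTopology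
  obtain ⟨CA, hCA⟩ := r.curvature.bounded
  refine Continuous.sub ?_ continuous_const
  unfold kerE
  exact continuous_integral_ymSpecification r.ρ r.continuous β _ (continuous_dens r x) (fun U => hCA _)

end Densities

end Summit.QuantumFields.YangMills.Cruxes.ResponseLocalisation.Far

end
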